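import Mathlib
import Summits.NavierStokesRegularity.NavierStokesRegularity.Theorems.ScenarioCensusHelicalSlabFlux
import HarnessLib

/-!
# Census row S7 (a): flows whose swirl velocity is axisymmetric have mean-free radial velocity
# on vertical periods

Support file for the scenario census of `NavierStokesRegularity` (cell `pub/ns-census`, block S,
row S7 = Bang–Gui–Wang–Xie, J. Fluid Mech. 1005 (2025) A6 = arXiv:2205.13259, Thm 1.4; tree FACT
`Literature.Analysis.FluidPDE.BangGuiWangXie2025_periodicSlab_liouville`). Case (a) of the printed
theorem ("`u^θ` is independent of `θ`") starts (§6, proof of Lemma 5.2, Step 1) from "Due to the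
divergence free property of `u` and the fact that `u^θ` is independent of `θ`, one has
`∂_r ∫₀¹ r u^r dz = −∫₀¹ ∂_z(r u^z) dz = 0` … This implies `∫₀¹ r u^r dz = 0`." Here is that
statement in Cartesian vocabulary (`r u^r = ⟪x_h, U⟫`, `r u^θ = swirl U`):

* `radial_verticalMean_eq_zero_of_swirl_axisymmetric` — for `U ∈ C¹` with bounded derivative,
  divergence free, axially `L`-periodic, whose swirl `Γ = swirl U` is an axisymmetric scalar:
  `∫₀ᴸ ⟪x_h, U(x + s e₃)⟫ ds = 0` for every `x`;
* `isAxisymmetricScalar_swirl_of_swirlVelocity` — the printed hypothesis (`u^θ` axisymmetric)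
  implies the axisymmetry of `Γ = r u^θ`;
* `eq_smul_eZ_of_const_of_swirlVelocity` — a CONSTANT field with axisymmetric `u^θ` is axial.

Proof of the first: for the vertical period integral `g` (`C¹`, `∂₃g = 0`, `div g = 0`,
`…HelicalSlabFlux`), the swirl `swirl g = ∫₀ᴸ Γ(· + s e₃) ds` is axisymmetric, so
`D(swirl g)(x)[Jx] = 0`, i.e. `⟪Jx, Dg(x) Jx⟫ = ⟪x_h, g x⟫`; with the trace identity
`⟪Dg x_h, x_h⟫ + ⟪Dg Jx, Jx⟫ = r² (∂₁g₁ + ∂₂g₂) = −r² ∂₃g₃ = 0` this gives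
`⟪Dg x_h, x_h⟫ + ⟪x_h, g⟫ = 0`, so `⟪x_h, g⟫` is constant along horizontal rays, hence `0`.

No summit statement and no census row is proved in this file.

## References

* J. Bang, C. Gui, Y. Wang, C. Xie, arXiv:2205.13259, §6 (proof of Lemma 5.2, Step 1; proof of
  Thm 1.4, Step 1). [BangGuiWangXie2025]
-/

-- the summit and its single problem share the name (D-0017 nested layout)
set_option linter.dupNamespace false

noncomputable section

open MeasureTheory Set Function Filter
open scoped Topology InnerProductSpace RealInnerProductSpace

namespace Summit.NavierStokesRegularity.NavierStokesRegularity.Theorems.ScenarioCensus.PeriodicSlab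

open Literature.Analysis Literature.Analysis.FluidPDE
open Summit.NavierStokesRegularity.NavierStokesRegularity.Theorems.ScenarioCensus.HelicalSlab

/-! ### Small algebra of the rotation generator -/

/-- `J(J x) = −x_h`. -/
theorem rotGen_rotGen_eq_neg_horizPart (x : EuclideanSpace ℝ (Fin 3)) :
    rotGen (rotGen x) = -horizPart x := by
  rw [horizPart_eq_toLp]
  ext i
  fin_cases i <;> simp [rotGen]

/-- `J` does not see the axial component: `J(x + s e₃) = J x`. -/
theorem rotGen_add_smul_eZ (x : EuclideanSpace ℝ (Fin 3)) (s : ℝ) : rotGen (x + s • eZ) = rotGen x := by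
  ext i
  fin_cases i <;> simp [rotGen, eZ]

/-- The printed hypothesis of case (a), "`u^θ` independent of `θ`", implies that the swirl
`Γ = r u^θ` is an axisymmetric scalar. -/
theorem isAxisymmetricScalar_swirl_of_swirlVelocity {U : EuclideanSpace ℝ (Fin 3) → EuclideanSpace ℝ (Fin 3)}
    (h : IsAxisymmetricScalar (swirlVelocity U)) : IsAxisymmetricScalar (swirl U) := by
  intro θ x
  by_cases hx : cylRadius x = 0
  · have hx' : cylRadius (rotZ θ x) = 0 := by rw [cylRadius_rotZ, hx]
    obtain ⟨h0, h1⟩ := (cylRadius_eq_zero_iff x).1 hx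
    obtain ⟨h0', h1'⟩ := (cylRadius_eq_zero_iff (rotZ θ x)).1 hx'
    simp only [swirl, h0, h1, h0', h1', zero_mul, sub_zero]
  · have hx' : cylRadius (rotZ θ x) ≠ 0 := by rw [cylRadius_rotZ]; exact hx
    rw [swirl_eq_cylRadius_mul_swirlVelocity U hx', swirl_eq_cylRadius_mul_swirlVelocity U hx,
      cylRadius_rotZ, h θ x]

/-- A CONSTANT field whose swirl velocity is axisymmetric is axial: `C = C₂ e₃`. -/
theorem eq_smul_eZ_of_const_of_swirlVelocity {C : EuclideanSpace ℝ (Fin 3)}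
    (h : IsAxisymmetricScalar (swirlVelocity fun _ : EuclideanSpace ℝ (Fin 3) => C)) :
    C = C 2 • eZ := by
  have hsw := isAxisymmetricScalar_swirl_of_swirlVelocity h
  -- `Γ(x) = x₀ C₁ − x₁ C₀` is rotation-invariant: evaluate at `e₀`, `e₁` and their half turns
  have h1 := hsw Real.pi (EuclideanSpace.single 0 1)
  have h2 := hsw Real.pi (EuclideanSpace.single 1 1)
  simp [swirl, Real.cos_pi, Real.sin_pi] at h1 h2
  ext i
  fin_cases i <;> simp [eZ] <;> linarith

/-! ### The flux lemma under axisymmetry of the swirl -/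

/-- **Flows with axisymmetric swirl have mean-free radial velocity on vertical periods**
(Bang–Gui–Wang–Xie, §6 Step 1, Cartesian form). Let `U ∈ C¹(ℝ³; ℝ³)` have bounded derivative, be
divergence free and axially `L`-periodic, and let its swirl `swirl U = r u^θ` be an axisymmetric
scalar. Then `∫₀ᴸ ⟪x_h, U(x + s e₃)⟫ ds = 0` for every `x`. -/
theorem radial_verticalMean_eq_zero_of_swirl_axisymmetric {L : ℝ}
    {U : EuclideanSpace ℝ (Fin 3) → EuclideanSpace ℝ (Fin 3)} (hU : ContDiff ℝ 1 U) {K : ℝ}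
    (hK : ∀ x, ‖fderiv ℝ U x‖ ≤ K) (hdiv : VectorCalculus.IsDivFree U)
    (hper : IsAxiallyPeriodic L U) (hsw : IsAxisymmetricScalar (swirl U))
    (x : EuclideanSpace ℝ (Fin 3)) :
    ∫ s in (0 : ℝ)..L, ⟪horizPart x, U (x + s • eZ)⟫ = 0 := by
  have hUc : Continuous U := hU.continuous
  have hUd : Differentiable ℝ U := hU.differentiable one_ne_zero
  have hDUc : Continuous (fderiv ℝ U) := hU.continuous_fderiv one_ne_zero
  have hline : ∀ y : EuclideanSpace ℝ (Fin 3), Continuous fun s : ℝ => y + s • (eZ : EuclideanSpace ℝ (Fin 3)) :=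
    fun y => continuous_const.add (continuous_id.smul continuous_const)
  -- the averaged field and its derivative
  set g : EuclideanSpace ℝ (Fin 3) → EuclideanSpace ℝ (Fin 3) := fun y => ∫ s in (0 : ℝ)..L, U (y + s • eZ)
    with hg
  set Dg : EuclideanSpace ℝ (Fin 3) → (EuclideanSpace ℝ (Fin 3) →L[ℝ] EuclideanSpace ℝ (Fin 3)) :=
    fun y => ∫ s in (0 : ℝ)..L, fderiv ℝ U (y + s • eZ) with hDg
  have hgD : ∀ y, HasFDerivAt g (Dg y) y := fun y => hasFDerivAt_verticalIntegral hU hK y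
  have hgd : Differentiable ℝ g := fun y => (hgD y).differentiableAt
  have hgF : ∀ y, fderiv ℝ g y = Dg y := fun y => (hgD y).fderiv
  have hDint : ∀ y, IntervalIntegrable (fun s : ℝ => fderiv ℝ U (y + s • eZ)) volume 0 L :=
    fun y => (hDUc.comp (hline y)).intervalIntegrable _ _
  have hgz : ∀ (y : EuclideanSpace ℝ (Fin 3)) (t : ℝ), g (y + t • eZ) = g y :=
    fun y t => verticalIntegral_add_smul_eZ hper y t
  -- `div g = 0`
  set τ : (EuclideanSpace ℝ (Fin 3) →L[ℝ] EuclideanSpace ℝ (Fin 3)) →L[ℝ] ℝ :=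
    LinearMap.toContinuousLinearMap
      ((LinearMap.trace ℝ (EuclideanSpace ℝ (Fin 3))).comp (ContinuousLinearMap.coeLM ℝ)) with hτ
  have hτ_apply : ∀ T : EuclideanSpace ℝ (Fin 3) →L[ℝ] EuclideanSpace ℝ (Fin 3),
      τ T = LinearMap.trace ℝ _ (T : EuclideanSpace ℝ (Fin 3) →ₗ[ℝ] EuclideanSpace ℝ (Fin 3)) :=
    fun T => rfl
  have hdivg : ∀ y, VectorCalculus.divergence g y = 0 := fun y => by
    rw [VectorCalculus.divergence, hgF y, ← hτ_apply, hDg, ← τ.intervalIntegral_comp_comm (hDint y)]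
    have : (fun s : ℝ => τ (fderiv ℝ U (y + s • eZ))) = fun _ => (0 : ℝ) := by
      funext s
      rw [hτ_apply]
      exact hdiv (y + s • eZ)
    rw [this, intervalIntegral.integral_const, smul_zero]
  -- `Dg(y) e₃ = 0`
  have hDg_eZ : ∀ y, fderiv ℝ g y eZ = 0 := fun y => by
    have h1 : HasDerivAt (fun t : ℝ => g (y + t • eZ)) (fderiv ℝ g (y + (0 : ℝ) • eZ) eZ) 0 :=
      hasDerivAt_comp_add_smul_eZ hgd y 0
    have h2 : (fun t : ℝ => g (y + t • eZ)) = fun _ => g y := funext fun t => hgz y t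
    rw [h2, zero_smul, add_zero] at h1
    exact h1.unique (hasDerivAt_const (0 : ℝ) (g y))
  -- the swirl of `g` is axisymmetric: `swirl g (y) = ∫₀ᴸ Γ(y + s e₃) ds`
  have hsw_g : IsAxisymmetricScalar (swirl g) := by
    have hrepr : ∀ y, swirl g y = ∫ s in (0 : ℝ)..L, swirl U (y + s • eZ) := by
      intro y
      rw [swirl_eq_inner_rotGen]
      show innerSL ℝ (rotGen y) (∫ s in (0 : ℝ)..L, U (y + s • eZ)) = _
      have hint : IntervalIntegrable (fun s : ℝ => U (y + s • eZ)) volume 0 L :=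
        (hUc.comp (hline y)).intervalIntegrable _ _
      rw [← (innerSL ℝ (rotGen y)).intervalIntegral_comp_comm hint]
      refine intervalIntegral.integral_congr fun s _ => ?_
      simp only [innerSL_apply_apply, swirl_eq_inner_rotGen, rotGen_add_smul_eZ]
    intro θ y
    rw [hrepr, hrepr]
    refine intervalIntegral.integral_congr fun s _ => ?_
    show swirl U (rotZ θ y + s • eZ) = swirl U (y + s • eZ)
    rw [← rotZ_add_smul_eZ, hsw θ]
  -- infinitesimal form: `⟪J y, Dg(y) J y⟫ = ⟪y_h, g y⟫`
  have hinf : ∀ y, ⟪rotGen y, fderiv ℝ g y (rotGen y)⟫ = ⟪horizPart y, g y⟫ := by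
    intro y
    have h1 : fderiv ℝ (swirl g) y (rotGen y) = 0 := hsw_g.fderiv_rotGen (differentiableAt_swirl (hgd y))
    rw [fderiv_swirl_apply (hgd y), rotGen_rotGen_eq_neg_horizPart, inner_neg_left] at h1
    linarith
  -- the key identity `⟪Dg(y) y_h, y_h⟫ + ⟪y_h, g y⟫ = 0`
  set b := EuclideanSpace.basisFun (Fin 3) ℝ with hb
  have key : ∀ y : EuclideanSpace ℝ (Fin 3),
      ⟪fderiv ℝ g y (horizPart y), horizPart y⟫ + ⟪horizPart y, g y⟫ = 0 := by
    intro y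
    set G := fderiv ℝ g y with hG
    have hb0 : b 0 = EuclideanSpace.single 0 (1 : ℝ) := by simp [hb]
    have hb1 : b 1 = EuclideanSpace.single 1 (1 : ℝ) := by simp [hb]
    have hb2 : b 2 = EuclideanSpace.single 2 (1 : ℝ) := by simp [hb]
    -- trace
    have htr : ⟪b 0, G (b 0)⟫ + ⟪b 1, G (b 1)⟫ + ⟪b 2, G (b 2)⟫ = 0 := by
      have h := divergence_eq_sum_inner_fderiv b g y
      rw [hdivg y, Fin.sum_univ_three] at h
      rw [hG]; linarith
    have htr' : G (b 0) 0 + G (b 1) 1 + G (b 2) 2 = 0 := by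
      have h := htr
      rw [hb0, hb1, hb2] at h ⊢
      simpa [EuclideanSpace.inner_single_left] using h
    -- axial column vanishes
    have hcol : G (b 2) = 0 := by rw [hb2, hG]; exact hDg_eZ y
    have hG22 : G (b 2) 2 = 0 := by rw [hcol]; rfl
    -- the swirl identity in coordinates
    have hsw' := hinf y
    rw [← hG, rotGen_eq_sub_single, map_sub, map_smul, map_smul, ← hb0, ← hb1] at hsw'
    rw [inner_horizPart_left] at hsw'
    have e0 : ⟪y 0 • b 1 - y 1 • b 0, y 0 • G (b 1) - y 1 • G (b 0)⟫ =
        y 0 * (y 0 * G (b 1) 1 - y 1 * G (b 0) 1) - y 1 * (y 0 * G (b 1) 0 - y 1 * G (b 0) 0) := by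
      rw [hb0, hb1]
      simp only [inner_sub_left, inner_sub_right, real_inner_smul_left, real_inner_smul_right,
        EuclideanSpace.inner_single_left, map_one, one_mul]
      ring
    rw [e0] at hsw'
    -- expand the goal in coordinates
    have hhp : horizPart y = y 0 • b 0 + y 1 • b 1 := by
      rw [horizPart_eq_toLp, hb0, hb1]; ext i; fin_cases i <;> simp
    have e1 : ⟪G (horizPart y), horizPart y⟫ =
        y 0 * (y 0 * G (b 0) 0 + y 1 * G (b 1) 0) + y 1 * (y 0 * G (b 0) 1 + y 1 * G (b 1) 1) := by
      rw [real_inner_comm, inner_horizPart_left, hhp, map_add, map_smul, map_smul]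
      simp only [PiLp.add_apply, PiLp.smul_apply, smul_eq_mul]
    have e2 : ⟪horizPart y, g y⟫ = y 0 * g y 0 + y 1 * g y 1 := inner_horizPart_left y (g y)
    rw [e1, e2]
    linear_combination (y 0 ^ 2 + y 1 ^ 2) * htr' - (y 0 ^ 2 + y 1 ^ 2) * hG22 - hsw'
  -- the flux function `h(y) = ⟪y_h, g y⟫` along the horizontal ray through `x`
  set h : EuclideanSpace ℝ (Fin 3) → ℝ := fun y => ⟪horizPart y, g y⟫ with hh
  have hhd : ∀ y, HasFDerivAt h ((innerSL ℝ (horizPart y)).comp (fderiv ℝ g y) +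
      (innerSL ℝ (g y)).comp horizPart) y := by
    intro y
    refine ((horizPart.hasFDerivAt (x := y)).inner ℝ (hgd y).hasFDerivAt).congr_fderiv ?_
    ext v
    simp only [_root_.add_apply, ContinuousLinearMap.comp_apply, innerSL_apply_apply,
      fderivInnerCLM_apply, ContinuousLinearMap.prod_apply]
    rw [real_inner_comm (g y)]
  have hhD : ∀ y v, fderiv ℝ h y v = ⟪horizPart y, fderiv ℝ g y v⟫ + ⟪g y, horizPart v⟫ := by
    intro y v
    rw [(hhd y).fderiv]
    simp only [_root_.add_apply, ContinuousLinearMap.comp_apply, innerSL_apply_apply]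
  set c : EuclideanSpace ℝ (Fin 3) := (x 2) • eZ with hc
  have hc0 : horizPart c = 0 := by rw [hc, map_smul, horizPart_eZ, smul_zero]
  have hray : ∀ t : ℝ, horizPart (c + t • horizPart x) = t • horizPart x := by
    intro t; rw [map_add, hc0, zero_add, map_smul, horizPart_horizPart]
  set ψ : ℝ → ℝ := fun t => h (c + t • horizPart x) with hψ
  have hψd : ∀ t, HasDerivAt ψ (fderiv ℝ h (c + t • horizPart x) (horizPart x)) t := by
    intro t
    have hl : HasDerivAt (fun τ : ℝ => c + τ • horizPart x) (horizPart x) t := by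
      have := ((hasDerivAt_id t).smul_const (horizPart x)).const_add c
      simpa using this
    exact ((hhd _).comp_hasDerivAt t hl).congr_deriv (by rw [(hhd _).fderiv])
  -- off the axis the derivative along the ray vanishes
  have hψ0 : ∀ t : ℝ, t ≠ 0 → fderiv ℝ h (c + t • horizPart x) (horizPart x) = 0 := by
    intro t ht
    set y := c + t • horizPart x with hy
    have hyh : horizPart y = t • horizPart x := hray t
    have hk := key y
    rw [hyh] at hk
    simp only [map_smul, real_inner_smul_left, real_inner_smul_right] at hk
    have e3 : ⟪horizPart x, fderiv ℝ g y (horizPart x)⟫ = ⟪fderiv ℝ g y (horizPart x), horizPart x⟫ :=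
      real_inner_comm _ _
    have e4 : ⟪g y, horizPart x⟫ = ⟪horizPart x, g y⟫ := real_inner_comm _ _
    rw [hhD, hyh, real_inner_smul_left, horizPart_horizPart, e3, e4]
    have h0 : t * (t * ⟪fderiv ℝ g y (horizPart x), horizPart x⟫ + ⟪horizPart x, g y⟫) = 0 := by
      linear_combination hk
    rcases mul_eq_zero.1 h0 with h1 | h1
    · exact absurd h1 ht
    · exact h1
  -- mean value theorem on `[0, 1]`
  have hψcont : ContinuousOn ψ (Icc 0 1) := fun t _ => (hψd t).continuousAt.continuousWithinAt
  have hψdiff : DifferentiableOn ℝ ψ (Ioo 0 1) := fun t _ => (hψd t).differentiableAt.differentiableWithinAt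
  obtain ⟨t₀, ht₀, hslope⟩ := exists_deriv_eq_slope ψ zero_lt_one hψcont hψdiff
  rw [(hψd t₀).deriv, hψ0 t₀ (ne_of_gt ht₀.1)] at hslope
  have hψ01 : ψ 1 = ψ 0 := by
    have : (ψ 1 - ψ 0) / (1 - 0) = 0 := hslope.symm
    rw [sub_zero, div_one] at this
    linarith
  have hψ0' : ψ 0 = 0 := by
    simp only [hψ, zero_smul, add_zero, hh, hc0, inner_zero_left]
  have hψ1 : ψ 1 = ∫ s in (0 : ℝ)..L, ⟪horizPart x, U (x + s • eZ)⟫ := by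
    have hxc : c + (1 : ℝ) • horizPart x = x := by
      rw [one_smul, hc, add_comm]; exact horizPart_add_apply_two_smul_eZ x
    simp only [hψ, hh, hxc, hg]
    show innerSL ℝ (horizPart x) (∫ s in (0 : ℝ)..L, U (x + s • eZ)) = _
    have hint : IntervalIntegrable (fun s : ℝ => U (x + s • eZ)) volume 0 L :=
      (hUc.comp (hline x)).intervalIntegrable _ _
    rw [← (innerSL ℝ (horizPart x)).intervalIntegral_comp_comm hint]
    simp only [innerSL_apply_apply]
  rw [← hψ1, hψ01, hψ0']

end Summit.NavierStokesRegularity.NavierStokesRegularity.Theorems.ScenarioCensus.PeriodicSlab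

end
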